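import Literature.AlgebraicGeometry.GroupSchemes.CartierDualLagrangian
import Literature.AlgebraicGeometry.GroupSchemes.CartierDualDoubleAnnihilator
import Literature.AlgebraicGeometry.GroupSchemes.KernelRecognitionByRank
import Literature.AlgebraicGeometry.GroupSchemes.IsIsoOrEtaleOfNatCard
import Literature.AlgebraicGeometry.Motives.AbelianVarietyFrobeniusKernelTorsion
import Literature.AlgebraicGeometry.Motives.AbelianVarietyTorsionKerRankProofs
import Literature.AlgebraicGeometry.Motives.AbelianVarietyTorsionCubeProofs
import HarnessLib

/-!
# Frobenius kernels are mutual annihilators under an `(F, V)`-adjoint duality of the `q`-torsion layers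
# ([Oda1969] Cor. 1.3 «`F` and `V` are adjoint for the Weil pairing»; [MumfordAV1970] §15 Thm. 1)

Topic `Literature/AlgebraicGeometry/Motives`; namespace `Literature.AlgebraicGeometry.Motives.AbelianVariety`.  THEOREMS ONLY (no
definition, no named fact, no instance, no notation, no `sorry`; net Literature debt 0).  Cell `hodgecm-mathlib` (D-0151), programme F0/P6
«MOD», the `w`-block ∕ (rL) supplier road of desk F0P6b-plan: organ **(W2-core)** = the mathematical content of letter (W2)
«`FrobeniusAnnihilator`» of the HOME line «F0_P6b_WeilCartierDuality» (A-p01 (g24) cand v1), typed GENERICALLY (no Weil family, no line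
definition): `--supports stmt-HodgeConjecture-24832`, count-neutral.  HONEST LABEL: HC_CM is proved only modulo the 2 remaining named inputs
(hLiu418 24832, h413 24833) until rung 0 closes; this file discharges none of them.

THE MATHEMATICS.  Let `k` be a perfect field of characteristic `p`, `q = p^r`, `A`, `B` abelian varieties over `k` of the SAME dimension `g`
(the case of record: `B = Â`), `F^{(r)}_X : X → X^{(q)}` the relative Frobenius (★ `relFrobenius`).  In the LAYER currency of the P6b lines
(closed subgroups realised by their `T`-points, ★ `cartierDual`, ★ `annihilator`): `j : G ↪ A` realises `A[q]`, `ĵ : Ĝ ↪ B` realises `B[q]`,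
`w : Ĝ ≅ G^D` is a duality (the Weil pairing `e_q`), `G′`, `Ĝ′ ↪ B^{(q)}` are layers with a duality `w′ : Ĝ′ ≅ G′^D`, and the
**`V`-SQUARE** `βF ≫ w′ = w ≫ (βV)^D` holds for a homomorphism `βV : G′ → G` killed by `F^{(r)}_A` (of record: the Verschiebung `V^{(r)}_A`
on `A^{(q)}[q]`, `F ∘ V = [q]`) and a lift `βF : Ĝ → Ĝ′` of `F^{(r)}_B` (of record: `(V_A)^∨ = F_Â`, ★ (DF) `DualIsogenyRelFrobenius`) —
«`⟨V x′, ŷ⟩ = ⟨x′, F ŷ⟩`».  Let `φ : Φ ↪ G` realise `A[F^{(r)}]` and `ψ : Ψ ↪ Ĝ` realise `B[F^{(r)}]`.  THEN `Φ^{⊥_w} = Ψ`: a `T`-point of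
`Ĝ` is `w`-orthogonal to `Φ` iff it is killed by `F^{(r)}_B` ([Oda1969] Cor. 1.3 `(Ker F_A)^⊥ = Ker F_Â`).
* (⊆, RANK-FREE) `comp_comp_relFrobenius_eq_one_of_comp_annihilatorι`: `βV` factors through `φ` (all-`T` characterisation), so for
  `x̂ ⊥ Φ` the `V`-square gives `w′(βF x̂) = (βV)^D(w x̂) = 1`, hence `βF x̂ = 1` and `F^{(r)}_B (ĵ x̂) = ĵ′(βF x̂) = 1`.
* (⊇, BY RANKS) the inclusion is a closed immersion `Φ^⊥ ↪ Ψ` of affine `k`-schemes of EQUAL rank: `rk Φ^⊥ = rk G ∕ rk Φ`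
  (★ `finrank_alg_annihilator_eq_div`, Tate (3.8)) `= q^{2g} ∕ q^{g}` (★ `kerRank_zsmul_id_holds` «`deg [n] = n^{2g}`», unconditional;
  ★ `finrank_ker_relFrobenius_hom` «`deg F^{(r)} = q^{g}`»; `Ker F^{(r)} ⊆ A[q]` by ★ (FK0)) `= q^{dim B} = rk Ψ`, hence an isomorphism
  (★ `isIso_of_isClosedImmersion_of_finrank_alg_eq`).
* §1–§3 tools: `exists_iso_ker_of_forall_exists_iff` (a realisation of a kernel subfunctor IS the chosen ★ `GroupSchemeKernel.ker`),
  `finrank_alg_eq_of_iso'`, `finrank_alg_eq_of_realises_torsion` (`rk A[q] = q^{2 dim A}`), `forall_exists_comp_comp_iff_comp_relFrobenius_eq_one`,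
  `finrank_alg_eq_of_realises_frobeniusKernel` (`rk A[F^{(r)}] = q^{dim A}`) (+ a private `isMonHom_of_comp_mono`).
* §5 (ED. 2) `pow_dim_eq_pow_dim_of_iso_cartierDual` (`Ĝ ≅ G^D` ⟹ `q^{dim A} = q^{dim B}`) and the DIMENSION-FREE head
  **`exists_comp_annihilatorι_comp_inv_iff_exists_comp_of_frobenius'`** (no `hdim`; the form the (W2) letter consumes — it has no polarization at hand).
* §4 HEAD **`exists_comp_annihilatorι_comp_inv_iff_exists_comp_of_frobenius`** — conclusion BYTE-SHAPED as the body of the line՚s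
  `WeilFamily.FrobeniusAnnihilates` (`(∃ c, c ≫ (annihilatorι φ ≫ w.inv) = x̂) ↔ ∃ s, s ≫ ψ = x̂`); the stub (W2) is this theorem at `B := Â`,
  `βV, βF :=` the lifts of `V^{(r)}_A`, `F^{(r)}_Â`, the square from `IsNatural` at `f := V^{(r)}_A` and `(V^{(r)}_A)^∨ = F^{(r)}_Â`.

## References
* [Oda1969] T. Oda, *The first de Rham cohomology group and Dieudonné modules*, Ann. Sci. ÉNS (4) 2 (1969), Thm. 1.1, Cor. 1.3.
* [MumfordAV1970] D. Mumford, *Abelian Varieties* (1970), §15 Thm. 1 (p. 143) and p. 146 (`deg F = q^g`), §7 Application 3 (p. 63).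
* [Tate1997FiniteFlatGroupSchemes] J. Tate, *Finite flat group schemes* (1997), §(3.7)–(3.8) pp. 144–146.
* [EdixhovenVanDerGeerMoonenAV] B. Edixhoven, G. van der Geer, B. Moonen, *Abelian Varieties* (draft), (5.21), (7.34); Ch. 5 §2 (`V ∘ F = [p]`).
* [GortzWedhorn2020] U. Görtz, T. Wedhorn, *Algebraic Geometry I*, 2nd ed. (2020), Definition 4.42 (p. 116), Definition 4.45 (2) (p. 117), Section (12.6).
* [GortzWedhorn2023] U. Görtz, T. Wedhorn, *Algebraic Geometry II* (2023), Prop. 27.186 (p. 887).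
-/

set_option autoImplicit false

-- Mathlib's `Over`/`Scheme` APIs are stated across semireducible wrappers (as in the ★ `GroupSchemes/*` files).
set_option backward.isDefEq.respectTransparency false

noncomputable section

universe u

open CategoryTheory CategoryTheory.Limits AlgebraicGeometry MonoidalCategory CartesianMonoidalCategory
open scoped MonObj

namespace Literature.AlgebraicGeometry.Motives.AbelianVariety

open Literature.AlgebraicGeometry.GroupSchemes Literature.AlgebraicGeometry.GroupSchemes.AffineGroupScheme
  Literature.AlgebraicGeometry.GroupSchemes.GroupSchemeKernel

variable {k : Type u} [Field k]

/-! ### §1 A realisation of a kernel subfunctor is isomorphic to the chosen kernel -/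

/-- **Two realisations of a kernel agree**: if `φ : Φ ⟶ X` is a monomorphism whose `T`-points are exactly the `T`-points of `X` killed
by `f : X ⟶ Y`, then `Φ ≅ Ker f` over `X` (Yoneda). [cite: GortzWedhorn2020, Definition 4.45 (2) (p. 117)] -/
theorem exists_iso_ker_of_forall_exists_iff {X Y Φ : Over (Spec (.of k))} [GrpObj Y] (f : X ⟶ Y) (φ : Φ ⟶ X) [Mono φ]
    (hΦ : ∀ ⦃T : Over (Spec (.of k))⦄ (t : T ⟶ X), (∃ s : T ⟶ Φ, s ≫ φ = t) ↔ t ≫ f = 1) :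
    ∃ e : Φ ≅ ker f, e.hom ≫ kerι f = φ := by
  have hφ : φ ≫ f = 1 := (hΦ φ).1 ⟨𝟙 Φ, Category.id_comp φ⟩
  obtain ⟨s, hs⟩ := (hΦ (kerι f)).2 (kerι_comp f)
  refine ⟨⟨kerLift φ hφ, s, ?_, ?_⟩, kerLift_ι φ hφ⟩
  · rw [← cancel_mono φ, Category.assoc, hs, kerLift_ι, Category.id_comp]
  · apply ker_hom_ext
    rw [Category.assoc, kerLift_ι, hs, Category.id_comp]

/-- `dim_k Γ` is invariant under isomorphisms of `k`-schemes with affine source and target (`Γ` is a functor).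
[cite: GortzWedhorn2020, Section (12.6)] -/
theorem finrank_alg_eq_of_iso' {X Y : Over (Spec (.of k))} [IsAffine X.left] [IsAffine Y.left] (e : X ≅ Y) :
    Module.finrank k (Alg X) = Module.finrank k (Alg Y) := by
  refine LinearEquiv.finrank_eq (AlgEquiv.ofAlgHom (Alg.comap e.inv) (Alg.comap e.hom) ?_ ?_).toLinearEquiv
  · rw [← Alg.comap_comp, Iso.inv_hom_id, Alg.comap_id]
  · rw [← Alg.comap_comp, Iso.hom_inv_id, Alg.comap_id]

/-! ### §2 Ranks of the layers: `rk A[q] = q^{2 dim A}`, `rk A[F^{(r)}] = q^{dim A}` for realisations by `T`-points -/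

section Ranks

variable [PerfectField k] (p : ℕ) [Fact p.Prime] [CharP k p] (r : ℕ) (A : AbelianVariety k)

variable (G : Over (Spec (.of k))) [IsAffine G.left] (j : G ⟶ A.X) [Mono j]
  (hG : ∀ ⦃T : Over (Spec (.of k))⦄ (t : T ⟶ A.X), (∃ s : T ⟶ G, s ≫ j = t) ↔ t ≫ ((((p ^ r : ℕ) : ℤ) • 𝟙 A).hom.hom.hom) = 1)

omit [PerfectField k] [CharP k p] in
include hG in
/-- **`rk Γ(A[q]) = q^{2 dim A}`** for any realisation `j : G ↪ A` of the `q = p^r`-torsion (★ `kerRank_zsmul_id_holds`: `deg [n] = n^{2g}`,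
unconditional; ★ `finrank_ker_hom_of_isIsogeny`; `G ≅ Ker [q]`). [cite: MumfordAV1970, §7 Application 3 (p. 63), §15 (p. 146)]
[cite: GortzWedhorn2023, Prop. 27.186 (p. 887)] -/
theorem finrank_alg_eq_of_realises_torsion : Module.finrank k (Alg G) = (p ^ r) ^ (2 * A.dim) := by
  have hq : (((p ^ r : ℕ) : ℤ)) ≠ 0 := by exact_mod_cast (pow_ne_zero r (Fact.out : p.Prime).ne_zero)
  have hiso : IsIsogeny ((((p ^ r : ℕ) : ℤ)) • 𝟙 A) := isIsogeny_zsmul_id_holds A _ hq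
  obtain ⟨e, -⟩ := exists_iso_ker_of_forall_exists_iff ((((p ^ r : ℕ) : ℤ) • 𝟙 A).hom.hom.hom) j hG
  haveI : IsFinite ((((p ^ r : ℕ) : ℤ) • 𝟙 A).hom.hom.hom).left := hiso.2
  haveI := isFinite_ker_hom_of_isFinite_left ((((p ^ r : ℕ) : ℤ) • 𝟙 A).hom.hom.hom)
  haveI : IsAffine (ker ((((p ^ r : ℕ) : ℤ) • 𝟙 A).hom.hom.hom)).left := isAffine_left_of_isAffineHom _
  obtain ⟨pt⟩ : Nonempty ↥(Spec (CommRingCat.of k)) := inferInstance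
  rw [finrank_alg_eq_of_iso' e, ← hom_finrank_eq_finrank_alg _ pt, finrank_ker_hom_of_isIsogeny _ hiso pt,
    kerRank_zsmul_id_holds A _ hq]
  simp [Int.natAbs_pow]

variable (Φ : Over (Spec (.of k))) [IsAffine Φ.left] (φ : Φ ⟶ G) [Mono φ]
  (hΦ : ∀ ⦃T : Over (Spec (.of k))⦄ (t : T ⟶ G), (∃ s : T ⟶ Φ, s ≫ φ = t) ↔ (t ≫ j) ≫ (A.relFrobenius p r).hom.hom.hom = 1)

omit [IsAffine G.left] [Mono j] [IsAffine Φ.left] [Mono φ] in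
include hG hΦ in
/-- The Frobenius-kernel layer `Φ ⊆ G = A[q]` realises `Ker F^{(r)}_{A∕k}` inside `A` (one-step form of `hΦ`, using `Ker F^{(r)} ⊆ A[q]`).
[cite: MumfordAV1970, §15 (p. 146)] -/
theorem forall_exists_comp_comp_iff_comp_relFrobenius_eq_one {T : Over (Spec (.of k))} (t : T ⟶ A.X) :
    (∃ s : T ⟶ Φ, s ≫ (φ ≫ j) = t) ↔ t ≫ (A.relFrobenius p r).hom.hom.hom = 1 := by
  constructor
  · rintro ⟨s, rfl⟩
    have h1 := (hΦ (s ≫ φ)).1 ⟨s, rfl⟩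
    simp only [Category.assoc] at h1 ⊢
    exact h1
  · intro ht
    obtain ⟨g, hg⟩ := (hG t).2 (comp_pow_zsmul_id_eq_one_of_comp_relFrobenius_eq_one p A r t ht)
    obtain ⟨s, hs⟩ := (hΦ g).2 (by rw [hg, ht])
    exact ⟨s, by rw [← Category.assoc, hs, hg]⟩

omit [IsAffine G.left] in
include hG hΦ in
/-- **`rk Γ(A[F^{(r)}]) = q^{dim A}`** for any realisation of the Frobenius-kernel layer (★ `finrank_ker_relFrobenius_hom`: `deg F^{(r)} = q^{dim A}`;
`Φ ≅ Ker F^{(r)}`). [cite: MumfordAV1970, §15 (p. 146)] -/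
theorem finrank_alg_eq_of_realises_frobeniusKernel : Module.finrank k (Alg Φ) = (p ^ r) ^ A.dim := by
  haveI : ExpChar k p := ExpChar.prime Fact.out
  haveI : Mono (φ ≫ j) := mono_comp _ _
  obtain ⟨e, -⟩ := exists_iso_ker_of_forall_exists_iff (A.relFrobenius p r).hom.hom.hom (φ ≫ j)
    (fun _ t => forall_exists_comp_comp_iff_comp_relFrobenius_eq_one p r A G j hG Φ φ hΦ t)
  haveI := isFinite_ker_relFrobenius_hom p r A
  haveI : IsAffine (ker (A.relFrobenius p r).hom.hom.hom).left := isAffine_left_of_isAffineHom _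
  obtain ⟨pt⟩ : Nonempty ↥(Spec (CommRingCat.of k)) := inferInstance
  rw [finrank_alg_eq_of_iso' e, ← hom_finrank_eq_finrank_alg _ pt, finrank_ker_relFrobenius_hom p r A pt, pow_mul]

end Ranks

/-! ### §3 A homomorphism into a subgroup through a monomorphism is a homomorphism -/

/-- If `s ≫ φ` is a homomorphism and `φ` is a monomorphic homomorphism then `s` is a homomorphism (cancel `φ` in the unit and
multiplication squares; private plumbing copy — B-p04 (g38)'s ★ `AffineGroupScheme.isMonHom_of_comp_mono` is the public form).
[cite: GortzWedhorn2020, Definition 4.42 (p. 116)] -/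
private theorem isMonHom_of_comp_mono {C : Type*} [Category C] [CartesianMonoidalCategory C] {X Y Z : C} [MonObj X] [MonObj Y] [MonObj Z]
    (s : X ⟶ Y) (φ : Y ⟶ Z) [Mono φ] [IsMonHom φ] [IsMonHom (s ≫ φ)] : IsMonHom s where
  one_hom := by
    rw [← cancel_mono φ, Category.assoc, IsMonHom.one_hom (s ≫ φ), IsMonHom.one_hom φ]
  mul_hom := by
    rw [← cancel_mono φ, Category.assoc, IsMonHom.mul_hom (s ≫ φ), Category.assoc, IsMonHom.mul_hom φ,
      ← MonoidalCategory.tensorHom_comp_tensorHom_assoc]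

/-! ### §4 HEAD — `(A[F^{(r)}])^⊥ = B[F^{(r)}]` under an `(F,V)`-adjoint duality `B[q] ≅ A[q]^D` -/

section Head

variable [PerfectField k] (p : ℕ) [Fact p.Prime] [CharP k p] (r : ℕ) (A B : AbelianVariety k)
  -- the `q`-torsion layers `G = A[q]`, `Ĝ = B[q]` and the duality `w`
  (G : SchemeOver k) [GrpObj G] [IsCommMonObj G] [IsAffine G.left] [Module.Free k (Alg G)] [Module.Finite k (Alg G)]
  (j : G ⟶ A.X) [IsClosedImmersion j.left]
  (Ĝ : SchemeOver k) (ĵ : Ĝ ⟶ B.X) [IsClosedImmersion ĵ.left]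
  (w : Ĝ ≅ cartierDual G)
  -- the `q`-torsion layers of the Frobenius twists `G′ ⊆ A^{(q)}`, `Ĝ′ ⊆ B^{(q)}` and the duality `w′`
  (G' : SchemeOver k) [GrpObj G'] [IsCommMonObj G'] [IsAffine G'.left] [Module.Free k (Alg G')] [Module.Finite k (Alg G')]
  (Ĝ' : SchemeOver k) [GrpObj Ĝ'] (ĵ' : Ĝ' ⟶ (B.frobeniusTwist p r).X) [IsMonHom ĵ']
  (w' : Ĝ' ≅ cartierDual G') [IsMonHom w'.hom]
  -- the `V`-square: `βV` lifts a map killed by `F^{(r)}_A` (the Verschiebung on `A^{(q)}[q]`), `βF` lifts `F^{(r)}_B`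
  (βV : G' ⟶ G) [IsMonHom βV] (βF : Ĝ ⟶ Ĝ')
  -- the Frobenius-kernel layers `Φ = A[F^{(r)}] ⊆ G`, `Ψ = B[F^{(r)}] ⊆ Ĝ`
  (Φ : SchemeOver k) [GrpObj Φ] [IsCommMonObj Φ] [IsAffine Φ.left] [Module.Free k (Alg Φ)] [Module.Finite k (Alg Φ)]
  (φ : Φ ⟶ G) [IsMonHom φ] [IsClosedImmersion φ.left]
  (Ψ : SchemeOver k) [IsAffine Ψ.left] [Module.Finite k (Alg Ψ)] (ψ : Ψ ⟶ Ĝ) [IsClosedImmersion ψ.left]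

omit [PerfectField k] [Module.Free k (Alg G)] [Module.Finite k (Alg G)] [IsClosedImmersion j.left] [IsClosedImmersion ĵ.left] in
/-- **ONE INCLUSION, rank-free: `(A[F^{(r)}])^{⊥_w} ⊆ B[F^{(r)}]`.**  If the character `w y` of `G = A[q]` is trivial on `Φ = A[F^{(r)}]`,
then `F^{(r)}_B y = 1`: by the `V`-square `w′(βF y) = (βV)^D (w y)`, and `βV` factors through `Φ` (it is killed by `F^{(r)}_A`), so
`(βV)^D (w y) = 1`; `w′` and `ĵ′` being monomorphic homomorphisms, `βF y = 1` and `y ≫ ĵ ≫ F^{(r)}_B = y ≫ βF ≫ ĵ′ = 1`.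
[cite: Oda1969, Thm. 1.1, Cor. 1.3] [cite: MumfordAV1970, §15 Thm. 1 (p. 143)] -/
theorem comp_comp_relFrobenius_eq_one_of_comp_annihilatorι
    (hβV : (βV ≫ j) ≫ (A.relFrobenius p r).hom.hom.hom = 1)
    (hβF : βF ≫ ĵ' = ĵ ≫ (B.relFrobenius p r).hom.hom.hom)
    (hsq : βF ≫ w'.hom = w.hom ≫ cartierDualMap βV)
    (hΦ : ∀ ⦃T : SchemeOver k⦄ (t : T ⟶ G), (∃ s : T ⟶ Φ, s ≫ φ = t) ↔ (t ≫ j) ≫ (A.relFrobenius p r).hom.hom.hom = 1)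
    {T : SchemeOver k} (c : T ⟶ annihilator φ) :
    ((c ≫ (annihilatorι φ ≫ w.inv)) ≫ ĵ) ≫ (B.relFrobenius p r).hom.hom.hom = 1 := by
  -- `βV` factors through `φ`, by a homomorphism
  obtain ⟨s₀, hs₀⟩ := (hΦ βV).2 hβV
  subst hs₀
  haveI : Mono φ := (Over.forget _).mono_of_mono_map (inferInstanceAs (Mono φ.left))
  haveI : IsMonHom s₀ := isMonHom_of_comp_mono s₀ φ
  -- the character `w x̂` dies on `G′`
  have h1 : c ≫ annihilatorι φ ≫ w.inv ≫ βF = 1 := by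
    rw [← cancel_mono w'.hom, Category.assoc, Category.assoc, Category.assoc, hsq, MonObj.one_comp, Iso.inv_hom_id_assoc,
      cartierDualMap_comp, reassoc_of% (annihilatorι_comp φ), MonObj.one_comp, MonObj.comp_one]
  simp only [Category.assoc]
  rw [← hβF, reassoc_of% h1, MonObj.one_comp]

/-- **HEAD — FROBENIUS KERNELS ARE MUTUAL ANNIHILATORS: `(A[F^{(r)}])^{⊥} = B[F^{(r)}]` under an `(F, V)`-adjoint duality of the
`q`-layers** ([Oda1969] Cor. 1.3: `F` and `V` are adjoint for the Weil pairing; here for ANY pair of abelian varieties `A`, `B` of the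
same dimension over a perfect field of characteristic `p`, `q = p^r`, ANY realisations `G ≅ A[q]`, `Ĝ ≅ B[q]` (all-`T` points), ANY
duality `w : Ĝ ≅ G^D`, and ANY `V`-square `βF ≫ w′ = w ≫ (βV)^D` with `βV : G′ → G` killed by `F^{(r)}_A` and `βF : Ĝ → Ĝ′` lifting
`F^{(r)}_B` into a layer `Ĝ′ ↪ B^{(q)}` dual to `G′` — the instance of record being `B = Â`, `βV = V^{(r)}_A|`, `βF = F^{(r)}_Â|`,
`(V_A)^∨ = F_Â`).  For every `k`-scheme `T`, a `T`-point `y` of `Ĝ` lies in the `w`-annihilator of `Φ = A[F^{(r)}]` (★ `annihilator φ`,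
read in `Ĝ` through `w⁻¹`) iff it lies in `Ψ = B[F^{(r)}]`.  PROOF: `⊆` is `comp_comp_relFrobenius_eq_one_of_comp_annihilatorι`; it yields a
closed immersion `Φ^⊥ ↪ Ψ`, an isomorphism by RANKS: `rk Φ^⊥ = rk G ∕ rk Φ = q^{2 dim A} ∕ q^{dim A}` (★ `finrank_alg_annihilator_eq_div`,
★ `kerRank_zsmul_id_holds`, ★ `finrank_ker_relFrobenius_hom`) `= q^{dim B} = rk Ψ` (★ `isIso_of_isClosedImmersion_of_finrank_alg_eq`).
[cite: Oda1969, Thm. 1.1, Cor. 1.3] [cite: MumfordAV1970, §15 Thm. 1 (p. 143), §15 (p. 146)] [cite: Tate1997FiniteFlatGroupSchemes, §(3.8) pp. 145–146] -/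
theorem exists_comp_annihilatorι_comp_inv_iff_exists_comp_of_frobenius (hdim : B.dim = A.dim)
    (hG : ∀ ⦃T : SchemeOver k⦄ (t : T ⟶ A.X), (∃ s : T ⟶ G, s ≫ j = t) ↔ t ≫ ((((p ^ r : ℕ) : ℤ) • 𝟙 A).hom.hom.hom) = 1)
    (hĜ : ∀ ⦃T : SchemeOver k⦄ (t : T ⟶ B.X), (∃ s : T ⟶ Ĝ, s ≫ ĵ = t) ↔ t ≫ ((((p ^ r : ℕ) : ℤ) • 𝟙 B).hom.hom.hom) = 1)
    (hβV : (βV ≫ j) ≫ (A.relFrobenius p r).hom.hom.hom = 1)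
    (hβF : βF ≫ ĵ' = ĵ ≫ (B.relFrobenius p r).hom.hom.hom)
    (hsq : βF ≫ w'.hom = w.hom ≫ cartierDualMap βV)
    (hΦ : ∀ ⦃T : SchemeOver k⦄ (t : T ⟶ G), (∃ s : T ⟶ Φ, s ≫ φ = t) ↔ (t ≫ j) ≫ (A.relFrobenius p r).hom.hom.hom = 1)
    (hΨ : ∀ ⦃T : SchemeOver k⦄ (t : T ⟶ Ĝ), (∃ s : T ⟶ Ψ, s ≫ ψ = t) ↔ (t ≫ ĵ) ≫ (B.relFrobenius p r).hom.hom.hom = 1)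
    ⦃T : SchemeOver k⦄ (y : T ⟶ Ĝ) :
    (∃ c : T ⟶ annihilator φ, c ≫ (annihilatorι φ ≫ w.inv) = y) ↔ ∃ s : T ⟶ Ψ, s ≫ ψ = y := by
  -- the comparison `i : Φ^⊥ ⟶ Ψ` from the rank-free inclusion
  obtain ⟨i, hi⟩ := (hΨ (𝟙 _ ≫ (annihilatorι φ ≫ w.inv))).2
    (comp_comp_relFrobenius_eq_one_of_comp_annihilatorι p r A B G j Ĝ ĵ w G' Ĝ' ĵ' w' βV βF Φ φ hβV hβF hsq hΦ (𝟙 _))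
  rw [Category.id_comp] at hi
  -- it is a closed immersion of affine `k`-schemes …
  haveI : IsAffine (annihilator φ).left := isAffine_annihilator_left φ
  haveI : Module.Finite k (Alg (annihilator φ)) := finite_alg_annihilator φ
  haveI : IsClosedImmersion (i ≫ ψ).left := by
    rw [hi, Over.comp_left]
    haveI := isClosedImmersion_annihilatorι_left φ
    infer_instance
  haveI : IsClosedImmersion i.left := by
    have : IsClosedImmersion (i.left ≫ ψ.left) := by rw [← Over.comp_left]; infer_instance
    exact IsClosedImmersion.of_comp i.left ψ.left
  -- … of equal rank `q^{dim A} = q^{dim B}`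
  haveI : Mono j := (Over.forget _).mono_of_mono_map (inferInstanceAs (Mono j.left))
  haveI : Mono ĵ := (Over.forget _).mono_of_mono_map (inferInstanceAs (Mono ĵ.left))
  haveI : Mono φ := (Over.forget _).mono_of_mono_map (inferInstanceAs (Mono φ.left))
  haveI : Mono ψ := (Over.forget _).mono_of_mono_map (inferInstanceAs (Mono ψ.left))
  have hq : 0 < p ^ r := pow_pos (Fact.out : p.Prime).pos r
  have hrk : Module.finrank k (Alg (annihilator φ)) = Module.finrank k (Alg Ψ) := by
    rw [finrank_alg_annihilator_eq_div φ, finrank_alg_eq_of_realises_torsion p r A G j hG,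
      finrank_alg_eq_of_realises_frobeniusKernel p r A G j hG Φ φ hΦ,
      finrank_alg_eq_of_realises_frobeniusKernel p r B Ĝ ĵ hĜ Ψ ψ hΨ, hdim, two_mul, pow_add,
      Nat.mul_div_cancel _ (pow_pos hq _)]
  haveI : IsIso i := isIso_of_isClosedImmersion_of_finrank_alg_eq i hrk
  constructor
  · rintro ⟨c, rfl⟩
    exact ⟨c ≫ i, by rw [Category.assoc, hi]⟩
  · rintro ⟨s, rfl⟩
    exact ⟨s ≫ inv i, by rw [Category.assoc, ← hi, IsIso.inv_hom_id_assoc]⟩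

end Head

/-! ### §5 (ED. 2) The equal-dimension hypothesis is automatic: `Ĝ ≅ G^D` forces `dim B = dim A` -/

section HeadNoDim

variable [PerfectField k] (p : ℕ) [Fact p.Prime] [CharP k p] (r : ℕ) (A B : AbelianVariety k)
  (G : SchemeOver k) [GrpObj G] [IsCommMonObj G] [IsAffine G.left] [Module.Free k (Alg G)] [Module.Finite k (Alg G)]
  (j : G ⟶ A.X) [IsClosedImmersion j.left]
  (Ĝ : SchemeOver k) [IsAffine Ĝ.left] (ĵ : Ĝ ⟶ B.X) [IsClosedImmersion ĵ.left]
  (w : Ĝ ≅ cartierDual G)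
  (G' : SchemeOver k) [GrpObj G'] [IsCommMonObj G'] [IsAffine G'.left] [Module.Free k (Alg G')] [Module.Finite k (Alg G')]
  (Ĝ' : SchemeOver k) [GrpObj Ĝ'] (ĵ' : Ĝ' ⟶ (B.frobeniusTwist p r).X) [IsMonHom ĵ']
  (w' : Ĝ' ≅ cartierDual G') [IsMonHom w'.hom]
  (βV : G' ⟶ G) [IsMonHom βV] (βF : Ĝ ⟶ Ĝ')
  (Φ : SchemeOver k) [GrpObj Φ] [IsCommMonObj Φ] [IsAffine Φ.left] [Module.Free k (Alg Φ)] [Module.Finite k (Alg Φ)]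
  (φ : Φ ⟶ G) [IsMonHom φ] [IsClosedImmersion φ.left]
  (Ψ : SchemeOver k) [IsAffine Ψ.left] [Module.Finite k (Alg Ψ)] (ψ : Ψ ⟶ Ĝ) [IsClosedImmersion ψ.left]

omit [PerfectField k] [CharP k p] in
include w in
/-- **`rk A[q]^{dim} = rk B[q]^{dim}` from the duality: `(p^r)^{dim A} = (p^r)^{dim B}`** — `Ĝ ≅ G^D` gives `rk Γ(B[q]) = rk Γ(A[q]^D) = rk Γ(A[q])`
(★ `finrank_alg_cartierDual`), i.e. `(q^{dim B})² = (q^{dim A})²`. [cite: MumfordAV1970, §15 Thm. 1 (p. 143)] [cite: Tate1997FiniteFlatGroupSchemes, §(3.8) p. 145] -/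
theorem pow_dim_eq_pow_dim_of_iso_cartierDual
    (hG : ∀ ⦃T : SchemeOver k⦄ (t : T ⟶ A.X), (∃ s : T ⟶ G, s ≫ j = t) ↔ t ≫ ((((p ^ r : ℕ) : ℤ) • 𝟙 A).hom.hom.hom) = 1)
    (hĜ : ∀ ⦃T : SchemeOver k⦄ (t : T ⟶ B.X), (∃ s : T ⟶ Ĝ, s ≫ ĵ = t) ↔ t ≫ ((((p ^ r : ℕ) : ℤ) • 𝟙 B).hom.hom.hom) = 1) :
    (p ^ r) ^ A.dim = (p ^ r) ^ B.dim := by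
  haveI : Mono j := (Over.forget _).mono_of_mono_map (inferInstanceAs (Mono j.left))
  haveI : Mono ĵ := (Over.forget _).mono_of_mono_map (inferInstanceAs (Mono ĵ.left))
  have e1 := finrank_alg_eq_of_realises_torsion p r B Ĝ ĵ hĜ
  have e2 := finrank_alg_eq_of_realises_torsion p r A G j hG
  have e3 : Module.finrank k (Alg Ĝ) = Module.finrank k (Alg G) := by rw [finrank_alg_eq_of_iso' w, finrank_alg_cartierDual]
  set x : ℕ := p ^ r with hx
  clear_value x
  have h : (x ^ B.dim) ^ 2 = (x ^ A.dim) ^ 2 := by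
    rw [← pow_mul, ← pow_mul, mul_comm B.dim 2, mul_comm A.dim 2, ← e1, ← e2, e3]
  exact (Nat.pow_left_injective two_ne_zero h).symm

/-- **HEAD, dimension-free form** — `exists_comp_annihilatorι_comp_inv_iff_exists_comp_of_frobenius` with `hdim` DISCHARGED by
`pow_dim_eq_pow_dim_of_iso_cartierDual` (the rank equality `rk Φ^⊥ = q^{2 dim A} ∕ q^{dim A} = q^{dim B} = rk Ψ` only needs `q^{dim A} = q^{dim B}`).
This is the shape the (W2) letter `FrobeniusAnnihilator` of the P6b line consumes (no polarization, hence no `dim Â = dim A` at hand).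
[cite: Oda1969, Thm. 1.1, Cor. 1.3] [cite: MumfordAV1970, §15 Thm. 1 (p. 143), §15 (p. 146)] [cite: Tate1997FiniteFlatGroupSchemes, §(3.8) pp. 145–146] -/
theorem exists_comp_annihilatorι_comp_inv_iff_exists_comp_of_frobenius'
    (hG : ∀ ⦃T : SchemeOver k⦄ (t : T ⟶ A.X), (∃ s : T ⟶ G, s ≫ j = t) ↔ t ≫ ((((p ^ r : ℕ) : ℤ) • 𝟙 A).hom.hom.hom) = 1)
    (hĜ : ∀ ⦃T : SchemeOver k⦄ (t : T ⟶ B.X), (∃ s : T ⟶ Ĝ, s ≫ ĵ = t) ↔ t ≫ ((((p ^ r : ℕ) : ℤ) • 𝟙 B).hom.hom.hom) = 1)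
    (hβV : (βV ≫ j) ≫ (A.relFrobenius p r).hom.hom.hom = 1)
    (hβF : βF ≫ ĵ' = ĵ ≫ (B.relFrobenius p r).hom.hom.hom)
    (hsq : βF ≫ w'.hom = w.hom ≫ cartierDualMap βV)
    (hΦ : ∀ ⦃T : SchemeOver k⦄ (t : T ⟶ G), (∃ s : T ⟶ Φ, s ≫ φ = t) ↔ (t ≫ j) ≫ (A.relFrobenius p r).hom.hom.hom = 1)
    (hΨ : ∀ ⦃T : SchemeOver k⦄ (t : T ⟶ Ĝ), (∃ s : T ⟶ Ψ, s ≫ ψ = t) ↔ (t ≫ ĵ) ≫ (B.relFrobenius p r).hom.hom.hom = 1)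
    ⦃T : SchemeOver k⦄ (y : T ⟶ Ĝ) :
    (∃ c : T ⟶ annihilator φ, c ≫ (annihilatorι φ ≫ w.inv) = y) ↔ ∃ s : T ⟶ Ψ, s ≫ ψ = y := by
  -- the comparison `i : Φ^⊥ ⟶ Ψ` from the rank-free inclusion
  obtain ⟨i, hi⟩ := (hΨ (𝟙 _ ≫ (annihilatorι φ ≫ w.inv))).2
    (comp_comp_relFrobenius_eq_one_of_comp_annihilatorι p r A B G j Ĝ ĵ w G' Ĝ' ĵ' w' βV βF Φ φ hβV hβF hsq hΦ (𝟙 _))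
  rw [Category.id_comp] at hi
  haveI : IsAffine (annihilator φ).left := isAffine_annihilator_left φ
  haveI : Module.Finite k (Alg (annihilator φ)) := finite_alg_annihilator φ
  haveI : IsClosedImmersion (i ≫ ψ).left := by
    rw [hi, Over.comp_left]
    haveI := isClosedImmersion_annihilatorι_left φ
    infer_instance
  haveI : IsClosedImmersion i.left := by
    have : IsClosedImmersion (i.left ≫ ψ.left) := by rw [← Over.comp_left]; infer_instance
    exact IsClosedImmersion.of_comp i.left ψ.left
  haveI : Mono j := (Over.forget _).mono_of_mono_map (inferInstanceAs (Mono j.left))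
  haveI : Mono ĵ := (Over.forget _).mono_of_mono_map (inferInstanceAs (Mono ĵ.left))
  haveI : Mono φ := (Over.forget _).mono_of_mono_map (inferInstanceAs (Mono φ.left))
  haveI : Mono ψ := (Over.forget _).mono_of_mono_map (inferInstanceAs (Mono ψ.left))
  have hq : 0 < p ^ r := pow_pos (Fact.out : p.Prime).pos r
  have hrk : Module.finrank k (Alg (annihilator φ)) = Module.finrank k (Alg Ψ) := by
    rw [finrank_alg_annihilator_eq_div φ, finrank_alg_eq_of_realises_torsion p r A G j hG,
      finrank_alg_eq_of_realises_frobeniusKernel p r A G j hG Φ φ hΦ,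
      finrank_alg_eq_of_realises_frobeniusKernel p r B Ĝ ĵ hĜ Ψ ψ hΨ,
      ← pow_dim_eq_pow_dim_of_iso_cartierDual p r A B G j Ĝ ĵ w hG hĜ, two_mul, pow_add,
      Nat.mul_div_cancel _ (pow_pos hq _)]
  haveI : IsIso i := isIso_of_isClosedImmersion_of_finrank_alg_eq i hrk
  constructor
  · rintro ⟨c, rfl⟩
    exact ⟨c ≫ i, by rw [Category.assoc, hi]⟩
  · rintro ⟨s, rfl⟩
    exact ⟨s ≫ inv i, by rw [Category.assoc, ← hi, IsIso.inv_hom_id_assoc]⟩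

end HeadNoDim

end Literature.AlgebraicGeometry.Motives.AbelianVariety

end
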